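import Literature.IUT.LogThetaLattice.GlobalPacketsLGPMonoidsOfGaussian
import Literature.IUT.LogThetaLattice.TensorPacketsGaloisAction
import Literature.IUT.LogThetaLattice.VerticallyCoricLGP
import HarnessLib

/-!
# [IUTchIII] Proposition 3.5 (i) CONSTRUCTED: the vertically coric LGP-monoids and their Kummer isomorphisms —
# `VerticallyCoricLGPData.ofKummer`, the inhabitant of the output signature over the genuine tensor packets,
# by NATURALITY of the Prop. 3.4 (ii) construction in Kummer isomorphisms of labeled data

S. Mochizuki, *Inter-universal Teichmüller theory III*, kurims manuscript (May 2020) `paper:url-4b091feeb646`,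
§3, Proposition 3.5 (i) "(Vertically Coric Local LGP-Monoids and Associated Kummer Theory)", p. 103 l. 35 –
p. 104 l. 28 (PRIMS offset ≈ +420) [claim: Mochizuki2012, status: disputed] for every quoted sentence; abc-iut
cell, layer L6, seat abc-iut-L6-t4 (typer of record of [IUTchIII] §3; gen 5). Node IUTchIII:Prop3.5(i) — the one
residual conjunct of [IUTchIII] §3 in the L6 layer certificate part B (`Layer6ResidualB`: per-item outcome of the
gen-0 typing «NEEDS: a construction», `VerticallyCoricLGPProofs.nonempty_verticallyCoricLGPData`).

PRINT. (p. 103 l. 40 – p. 104 l. 7) "Recall the constructions of Proposition 3.4, (ii), involving 𝓕-prime-strip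
processions. Then by applying these constructions to the 𝓕-prime-strips '`𝔉(^{n,∘}𝔇_≻)_t`' and the various full
log-links associated … to these 𝓕-prime-strips … we obtain a functorial algorithm in the 𝒟-Θ^{±ell}NF-Hodge theater
`^{n,∘}𝓗𝓣^{𝒟-Θ^{±ell}NF}` for constructing [collections of] monoids `𝕍 ∋ v ↦ Ψ_LGP(^{n,∘}𝓗𝓣^{𝒟-Θ^{±ell}NF})_v`;
`𝕍 ∋ v ↦ ∞Ψ_LGP(^{n,∘}𝓗𝓣^{𝒟-Θ^{±ell}NF})_v` equipped with actions by topological groups when `v ∈ 𝕍^non` and splittings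
[up to torsion, when `v ∈ 𝕍^bad`] — which we refer to as 'vertically coric [local] LGP-monoids'." (p. 104 l. 7–19)
"For each `n, m ∈ ℤ`, this functorial algorithm is compatible [in the evident sense] with the functorial algorithm of
Proposition 3.4, (ii) — i.e., where we take '†' to be '`n,m`' and '‡' to be '`n,m−1`' — relative to the Kummer
isomorphisms of labeled data `Ψ_cns(^{n,m'}𝔉_≻)_t ⥲ Ψ_cns(^{n,∘}𝔇_≻)_t` of [IUTchII], Corollary 4.6, (iii), and the
evident identification, for `m' = m, m−1`, of `^{n,m'}𝔉_t` … with the 𝓕-prime-strip associated to `Ψ_cns(^{n,m'}𝔉_≻)_t`."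
(p. 104 l. 19–28) "In particular, for each `n, m ∈ ℤ`, we obtain Kummer isomorphisms of [collections of] monoids
`Ψ_{𝓕_LGP}(^{n,m}𝓗𝓣^{Θ^{±ell}NF})_v ⥲ Ψ_LGP(^{n,∘}𝓗𝓣^{𝒟-Θ^{±ell}NF})_v`; `∞Ψ_{𝓕_LGP}(…)_v ⥲ ∞Ψ_LGP(…)_v` equipped with actions
by topological groups when `v ∈ 𝕍^non` and splittings [up to torsion, when `v ∈ 𝕍^bad`], for `v ∈ 𝕍`."

WHAT IS BUILT (places of one nonarchimedean fibre `Vfib = {v ∣ p}`, as in gen 4's `GlobalPacketsLGPMonoidsOfGaussian`):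
* §1 `PacketAt.congrAlg`: abc-iut-L6-t4's `(A, α)`-packet `log(^{A,α}𝓕_v) = log(^α𝓕_v) ⊗ (⊗_{β≠α} ⊕_w log(^β𝓕_w))`
  (Prop. 3.1 (ii)) is FUNCTORIAL in families of `𝕜`-algebra isomorphisms of the factor fields
  (`Algebra.TensorProduct.congr` × gen 4's `piTensorMapAlgEquiv` × `AlgEquiv.piCongrRight`) and the functoriality is
  NATURAL for `toPacketAt` ("tensor with 1's") — `PacketAt.congrAlg_toPacketAt`;
* §2 `lgpPacketCongr e v j : log(^{S^±_{j+1},j}𝔉') ≃ₐ log(^{S^±_{j+1},j}𝔉)` — the transport of the label-`j` LGP packets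
  induced by an identification `e_w : log(𝔉'_w) ⥲ log(𝔉_w)` of 𝓕-prime-strip fields; **`map_lgpComponent_congr`**: the
  Prop. 3.4 (ii) construction `lgpComponent` (image of `pr_j(S)` under `toPacketAt_j ∘ ι_v`) is NATURAL — for a
  Kummer isomorphism of labeled monoid data `κ_v : M'_v ≃* M_v` ([IUTchII] Cor. 4.6 (iii); labelwise = abc-iut-L6-t2's
  `piIso`), an identification `e_v` of the carrier fields, and members `ι'_v`, `ι_v` of the log-links' poly-isomorphisms
  chosen compatibly (`e ∘ ι' = ι ∘ κ`: "which we consider in a fashion compatible with …", p. 103 l. 43–45), the packet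
  transport carries the component built from `S ⊆ ∏_{F_l^⋇} M'_v` ONTO the component built from `κ(S)`;
* §3 **`VerticallyCoricLGPData.ofKummer`** — the inhabitant of abc-iut-L6-t4's gen-0 OUTPUT SIGNATURE
  `VerticallyCoricLGPData` (p403950) with carriers the genuine packets: `Ψ_LGP(^{n,∘}𝓗𝓣)_v` := gen 4's
  `LGPMonoidSignature.ofGaussian` applied to the étale-like (coric) data (`K`, `M`, `ι`, `gau`, …) = "applying these
  constructions to the 𝓕-prime-strips `𝔉(^{n,∘}𝔇_≻)_t` and [their] full log-links"; `Ψ_{𝓕_LGP}(^{n,m}𝓗𝓣)_v` := the same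
  construction at the Frobenius-like data of index `m` (`Km m`, `Mm m`, `ιm m`, `gaum m`, …); the **Kummer isomorphisms**
  `kummer m v j : Ψ_{𝓕_LGP}(^{n,m})_{v,j} ≃* Ψ_LGP(^{n,∘})_{v,j}` (and `∞`-versions) := the packet transport `lgpPacketCongr (e m)`
  RESTRICTED (`MulEquiv.submonoidMap` + `map_lgpComponent_congr`) — so "compatible [in the evident sense] with the
  functorial algorithm of Proposition 3.4, (ii) … relative to the Kummer isomorphisms of labeled data" is a THEOREM
  (`ofKummer_ΨF`, `ofKummer_kummer_coe`), "vertically coric" = the étale-like output has no `m`-dependence BY TYPE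
  (`ofKummer_Ψcoric`), "splittings [up to torsion, when `v ∈ 𝕍^bad`]" = the splitting monoids correspond
  (`ofGaussian_ΨSplit_map_congr`); "equipped with actions by topological groups" = companion file;
* companion file `VerticallyCoricLGPKummerTransport.lean` (same seat): the Galois-invariant parts correspond
  (`ofGaussian_ΨGal_map_congr`), and the hypothesis-free instance `VerticallyCoricLGPData.ofKummerTransport'` — Frobenius-like
  Gaussian data := the coric data TRANSPORTED along `κ` (= abc-iut-L6-t2's [IUTchII] Cor. 3.6 (ii) `frobenioidGaussianMonoid` BY
  NAME for value profiles) and the compatible member `ι_m := e⁻¹ ∘ ι ∘ κ`, discharging `hcompat`/`hgau`/`hgauInf` below.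

INPUTS BY NAME (edges, not endorsed): the Kummer isomorphisms of labeled data `κ` and the 𝓕-prime-strip identifications
`e` are the OUTPUTS of [IUTchII] Cor. 4.6 (iii) / Rmk. 4.5.1 (i) (abc-iut-L6-t2 `Cor46Statements.symmetrizing`, SLOT) read at
the level of the carrier monoids/fields; the log-link members `ι` are explicit parameters exactly as in gen 4 (abc-iut-L6-t3's
`LogLink.polyIso` carries no ring-level member). HONEST SCOPE: one nonarchimedean fibre (archimedean places: gen 4's
`LGPMonoidSignature.ofGaussianArch`, same naturality, not repeated here); topologies and the `F^{⋊±}_l`-symmetry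
compatibility (p. 103 l. 44–45) are not modelled; "functorial algorithm" = a definition in the inputs; (ii) "upper
semi-compatibility" is NOT this file (abc-iut-w4-d036 / L6-t4 `VerticallyCoricLGP*` companions). No `Prop`-valued
definition, no instance, no named fact; nothing here asserts abc proved or refuted or takes a side on [IUTchIII]
Cor. 3.12; constructed-as-junction ≠ upstream nodes discharged; instantiated ≠ endorsed.
-/

noncomputable section

namespace Literature.IUT.LogThetaLattice

open scoped TensorProduct
open PiTensorProduct
open Literature.IUT.HodgeArakelov Literature.AnabelianGeometry.AbsoluteAnabelian

universe u v v' w w' w₁ w₂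

/-! ### 1. Functoriality of the packets of Proposition 3.1 in isomorphisms of the factor fields -/

section PacketCongr

variable (𝕜 : Type u) [Field 𝕜] {A : Type v} {Vfib : Type v'}
variable (L : A → Vfib → Type w) [∀ α v, CommRing (L α v)] [∀ α v, Algebra 𝕜 (L α v)]
variable (L' : A → Vfib → Type w') [∀ α v, CommRing (L' α v)] [∀ α v, Algebra 𝕜 (L' α v)]

/-- The isomorphism of 1-tensor packets `log(^α𝓕_{v_ℚ}) = ⊕_v log(^α𝓕_v) ⥲ ⊕_v log(^α𝓕'_v)` induced by a family of
`𝕜`-algebra isomorphisms `e_{α,v} : log(^α𝓕_v) ⥲ log(^α𝓕'_v)` of the factor fields — e.g. the identification of two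
𝓕-prime-strips along a Kummer isomorphism ([IUTchIII] Prop. 3.5 (i) p. 104 l. 15 "the evident identification").
[cite: Mochizuki2012, Prop. 3.1 (i) p.92] [claim: Mochizuki2012, status: disputed] -/
def Packet1.congrAlg (e : ∀ α v, L α v ≃ₐ[𝕜] L' α v) (α : A) : Packet1 L α ≃ₐ[𝕜] Packet1 L' α :=
  AlgEquiv.piCongrRight fun v => e α v

/-- `Packet1.congrAlg` is componentwise. [cite: Mochizuki2012, Prop. 3.1 (i) p.92] [claim: Mochizuki2012, status: disputed] -/
@[simp] theorem Packet1.congrAlg_apply (e : ∀ α v, L α v ≃ₐ[𝕜] L' α v) (α : A) (x : Packet1 L α) (v : Vfib) :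
    Packet1.congrAlg 𝕜 L L' e α x v = e α v (x v) := rfl

/-- **Functoriality of the `(A, α)`-packet `log(^{A,α}𝓕_v) = log(^α𝓕_v) ⊗ (⊗_{β≠α} log(^β𝓕_{v_ℚ}))` ([IUTchIII] Prop. 3.1 (ii)
p. 93) in isomorphisms of the factor fields**: a family `e_{α,v} : log(^α𝓕_v) ⥲ log(^α𝓕'_v)` of `𝕜`-algebra isomorphisms
induces `log(^{A,α}𝓕_v) ⥲ log(^{A,α}𝓕'_v)` — "the isomorphism on `log(^α𝓕_v)` ⊗ the tensor product of the induced isomorphisms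
of the other factors" (`Algebra.TensorProduct.congr`, `piTensorMapAlgEquiv`). [cite: Mochizuki2012, Prop. 3.1 (ii) p.93]
[claim: Mochizuki2012, status: disputed] -/
def PacketAt.congrAlg (e : ∀ α v, L α v ≃ₐ[𝕜] L' α v) (α : A) (v : Vfib) :
    PacketAt 𝕜 L α v ≃ₐ[𝕜] PacketAt 𝕜 L' α v :=
  Algebra.TensorProduct.congr (e α v)
    (piTensorMapAlgEquiv fun β : {β : A // β ≠ α} => Packet1.congrAlg 𝕜 L L' e β.1)

/-- On pure tensors: `congrAlg e (x ⊗ (⊗_β y_β)) = e(x) ⊗ (⊗_β e(y_β))`. [cite: Mochizuki2012, Prop. 3.1 (ii) p.93]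
[claim: Mochizuki2012, status: disputed] -/
@[simp] theorem PacketAt.congrAlg_tmul_tprod (e : ∀ α v, L α v ≃ₐ[𝕜] L' α v) (α : A) (v : Vfib)
    (x : L α v) (y : ∀ β : {β : A // β ≠ α}, Packet1 L β.1) :
    PacketAt.congrAlg 𝕜 L L' e α v (x ⊗ₜ[𝕜] tprod 𝕜 y) =
      e α v x ⊗ₜ[𝕜] tprod 𝕜 (fun β => Packet1.congrAlg 𝕜 L L' e β.1 (y β)) := by
  change Algebra.TensorProduct.congr _ _ (x ⊗ₜ[𝕜] tprod 𝕜 y) = _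
  rw [Algebra.TensorProduct.congr_apply, Algebra.TensorProduct.map_tmul]
  simp

/-- **NATURALITY of `log(^α𝓕_v) → log(^{A,α}𝓕_v)`** ([IUTchIII] Prop. 3.1 (ii) p. 93, abc-iut-L6-t4's `toPacketAt`, "tensor with
1's"): the packet isomorphism induced by `e` restricts on `log(^α𝓕_v)` to `e_{α,v}` — `congrAlg e ∘ toPacketAt = toPacketAt ∘ e_{α,v}`.
PROVED. [cite: Mochizuki2012, Prop. 3.1 (ii) p.93] [claim: Mochizuki2012, status: disputed] -/
theorem PacketAt.congrAlg_toPacketAt (e : ∀ α v, L α v ≃ₐ[𝕜] L' α v) (α : A) (v : Vfib) (x : L α v) :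
    PacketAt.congrAlg 𝕜 L L' e α v (toPacketAt 𝕜 L α v x) = toPacketAt 𝕜 L' α v (e α v x) := by
  change Algebra.TensorProduct.congr _ _ (x ⊗ₜ[𝕜] 1) = e α v x ⊗ₜ[𝕜] 1
  rw [Algebra.TensorProduct.congr_apply, Algebra.TensorProduct.map_tmul, map_one]
  rfl

/-- Naturality for the inverse isomorphism. [cite: Mochizuki2012, Prop. 3.1 (ii) p.93] [claim: Mochizuki2012, status: disputed] -/
theorem PacketAt.congrAlg_symm_toPacketAt (e : ∀ α v, L α v ≃ₐ[𝕜] L' α v) (α : A) (v : Vfib) (x : L' α v) :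
    (PacketAt.congrAlg 𝕜 L L' e α v).symm (toPacketAt 𝕜 L' α v x) = toPacketAt 𝕜 L α v ((e α v).symm x) := by
  apply (PacketAt.congrAlg 𝕜 L L' e α v).injective
  rw [AlgEquiv.apply_symm_apply, PacketAt.congrAlg_toPacketAt, AlgEquiv.apply_symm_apply]

end PacketCongr

/-! ### 2. The transport of the LGP packets along an identification of 𝓕-prime-strip fields, and the NATURALITY of the
Prop. 3.4 (ii) construction in Kummer isomorphisms of labeled data -/

section Naturality

variable (p : ℕ) [Fact p.Prime] {Vfib : Type v'}
variable (K : Vfib → Type w) [∀ v, NontriviallyNormedField (K v)] [∀ v, Algebra ℚ_[p] (K v)]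
variable (K' : Vfib → Type w) [∀ v, NontriviallyNormedField (K' v)] [∀ v, Algebra ℚ_[p] (K' v)]
variable {lstar : ℕ}

/-- **The transport `log(^{S^±_{j+1},j}𝔉'_v) ⥲ log(^{S^±_{j+1},j}𝔉_v)` of the label-`j` LGP packets** (gen 4's `LGPPacket`, [IUTchIII]
Prop. 3.4 (ii) p. 103 l. 8) induced by an identification `e_w : log(𝔉'_w) ⥲ log(𝔉_w)` (`w ∣ p`) of the fields of two 𝓕-prime-strips
— in Prop. 3.5 (i): of `^{n,m−1}𝔉_t` with the 𝓕-prime-strip `𝔉(^{n,∘}𝔇_≻)_t` "associated to `Ψ_cns(…)_t`" along the Kummer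
isomorphism of [IUTchII] Cor. 4.6 (iii) (p. 104 l. 15–19 "the evident identification, for `m' = m, m−1`, of `^{n,m'}𝔉_t` …").
Every factor of the `(j+1)`-capsule is a copy of the same strip (`capsuleFields`), so `e` acts in every factor.
[cite: Mochizuki2012, Prop. 3.5 (i) p.104] [claim: Mochizuki2012, status: disputed] -/
def lgpPacketCongr (e : ∀ v, K' v ≃ₐ[ℚ_[p]] K v) (v : Vfib) (j : Fin lstar) :
    LGPPacket p K' v j ≃ₐ[ℚ_[p]] LGPPacket p K v j :=
  PacketAt.congrAlg ℚ_[p] (capsuleFields K' (labelNat j)) (capsuleFields K (labelNat j)) (fun _ w => e w)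
    (Fin.last (labelNat j)) v

/-- The packet transport restricts on `log(^j𝔉'_v) = K'_v` to `e_v` (naturality of `toLGPPacket`).
[cite: Mochizuki2012, Prop. 3.5 (i) p.104] [claim: Mochizuki2012, status: disputed] -/
theorem lgpPacketCongr_toLGPPacket (e : ∀ v, K' v ≃ₐ[ℚ_[p]] K v) (v : Vfib) (j : Fin lstar) (x : K' v) :
    lgpPacketCongr p K K' e v j (toLGPPacket p K' v j x) = toLGPPacket p K v j (e v x) :=
  PacketAt.congrAlg_toPacketAt ℚ_[p] (capsuleFields K' (labelNat j)) (capsuleFields K (labelNat j))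
    (fun _ w => e w) (Fin.last (labelNat j)) v x

variable (M : Vfib → Type w₁) [∀ v, CommMonoid (M v)] (ι : ∀ v, M v →* K v)
variable (M' : Vfib → Type w₂) [∀ v, CommMonoid (M' v)] (ι' : ∀ v, M' v →* K' v)
variable (κ : ∀ v, M' v ≃* M v) (e : ∀ v, K' v ≃ₐ[ℚ_[p]] K v)

/-- For COMPATIBLE members `ι'_v`, `ι_v` of the two log-links' poly-isomorphisms (`e_v ∘ ι'_v = ι_v ∘ κ_v`: p. 103 l. 43–45
"which we consider in a fashion compatible with …"), the packet transport intertwines gen 4's label-`j` pushes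
`lgpPush = toPacketAt_j ∘ ι`: `Φ (lgpPush' x) = lgpPush (κ x)`. [cite: Mochizuki2012, Prop. 3.5 (i) p.104]
[claim: Mochizuki2012, status: disputed] -/
theorem lgpPacketCongr_lgpPush (hcompat : ∀ v x, e v (ι' v x) = ι v (κ v x)) (v : Vfib) (j : Fin lstar)
    (x : M' v) :
    lgpPacketCongr p K K' e v j (lgpPush p K' M' ι' v j x) = lgpPush p K M ι v j (κ v x) := by
  change lgpPacketCongr p K K' e v j (toLGPPacket p K' v j (ι' v x)) = toLGPPacket p K v j (ι v (κ v x))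
  rw [lgpPacketCongr_toLGPPacket, hcompat]

/-- **NATURALITY of the Proposition 3.4 (ii) construction in Kummer isomorphisms of labeled data** ([IUTchIII] Prop. 3.5 (i)
p. 104 l. 7–15 "this functorial algorithm is compatible [in the evident sense] with the functorial algorithm of Proposition
3.4, (ii) … relative to the Kummer isomorphisms of labeled data `Ψ_cns(^{n,m'}𝔉_≻)_t ⥲ Ψ_cns(^{n,∘}𝔇_≻)_t` of [IUTchII],
Corollary 4.6, (iii)"): for a Kummer isomorphism `κ_v : M'_v ≃* M_v` of the labeled monoid data (labelwise: abc-iut-L6-t2's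
`piIso`), an identification `e_v` of the carrier fields and compatible members, the packet transport carries gen 4's
label-`j` component `lgpComponent` built from ANY `S ⊆ ∏_{F_l^⋇} M'_v` onto the component built from `κ(S) ⊆ ∏_{F_l^⋇} M_v`.
PROVED. [cite: Mochizuki2012, Prop. 3.5 (i) p.104] [claim: Mochizuki2012, status: disputed] -/
theorem map_lgpComponent_congr (hcompat : ∀ v x, e v (ι' v x) = ι v (κ v x)) (v : Vfib)
    (S : Submonoid (Fin lstar → M' v)) (j : Fin lstar) :
    (lgpComponent p K' M' ι' v S j).map (lgpPacketCongr p K K' e v j).toMulEquiv =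
      lgpComponent p K M ι v (S.map (piIso (Fin lstar) (κ v)).toMonoidHom) j := by
  ext y
  simp only [Submonoid.mem_map, mem_lgpComponent_iff]
  constructor
  · rintro ⟨z, ⟨x, hx, rfl⟩, rfl⟩
    refine ⟨piIso (Fin lstar) (κ v) x, ⟨x, hx, rfl⟩, ?_⟩
    change lgpPush p K M ι v j (κ v (x j)) = _
    rw [← lgpPacketCongr_lgpPush p K K' M ι M' ι' κ e hcompat]
    rfl
  · rintro ⟨_, ⟨x, hx, rfl⟩, rfl⟩
    refine ⟨lgpPush p K' M' ι' v j (x j), ⟨x, hx, rfl⟩, ?_⟩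
    change lgpPacketCongr p K K' e v j (lgpPush p K' M' ι' v j (x j)) = lgpPush p K M ι v j (κ v (x j))
    exact lgpPacketCongr_lgpPush p K K' M ι M' ι' κ e hcompat v j (x j)

end Naturality

/-! ### 3. Proposition 3.5 (i) CONSTRUCTED: `VerticallyCoricLGPData.ofKummer` -/

section Construction

variable (p : ℕ) [Fact p.Prime] {Vfib : Type v'} [Fintype Vfib]
/- coric (étale-like, index `(n,∘)`) carriers: the fields `log(𝔉(^{n,∘}𝔇_≻)_v)`, `v ∣ p`, with their log-shell data -/
variable (K : Vfib → Type w) [∀ v, NontriviallyNormedField (K v)] [∀ v, Algebra ℚ_[p] (K v)]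
  [∀ v, IsBoundedSMul ℚ_[p] (K v)] [∀ v, IsUltrametricDist (K v)] [∀ v, CharZero (K v)]
variable (Lg : ∀ v, PadicLogOnUnits (K v))
/- Frobenius-like carriers at `(n,m)`: the fields `log(^{n,m−1}𝓕_v)` (‡ = `(n,m−1)` in Prop. 3.4 (ii)) -/
variable (Km : ℤ → Vfib → Type w) [∀ m v, NontriviallyNormedField (Km m v)] [∀ m v, Algebra ℚ_[p] (Km m v)]
  [∀ m v, IsBoundedSMul ℚ_[p] (Km m v)] [∀ m v, IsUltrametricDist (Km m v)] [∀ m v, CharZero (Km m v)]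
variable (Lgm : ∀ m v, PadicLogOnUnits (Km m v))
variable {lstar : ℕ} (isBad : Vfib → Prop)
/- coric labeled monoid data `Ψ_cns(^{n,∘}𝔇_≻)` with its `G_v`-action, member `ι` of the full log-link, Gaussian data -/
variable (M : Vfib → Type w₁) [∀ v, CommMonoid (M v)]
variable (Γ : Vfib → Type w₂) [∀ v, Monoid (Γ v)] [∀ v, MulDistribMulAction (Γ v) (M v)]
variable (ι : ∀ v, M v →* K v)
variable (gau gauInf : ∀ v, Submonoid (Fin lstar → M v))
variable (split : ∀ v, isBad v → Submonoid (Fin lstar → M v))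
variable (split_le : ∀ v (h : isBad v), split v h ≤ gau v)
/- Frobenius-like labeled data `Ψ_cns(^{n,m}𝔉_≻)` at each `m` (†-side of the log-link `(n,m−1) → (n,m)`), `G_v` acting
through the identifications of the 𝒟-prime-strips (vertical coricity, [IUTchIII] Thm. 1.5 (i)) -/
variable (Mm : ℤ → Vfib → Type w₁) [∀ m v, CommMonoid (Mm m v)] [∀ m v, MulDistribMulAction (Γ v) (Mm m v)]
variable (ιm : ∀ m v, Mm m v →* Km m v)
variable (gaum gauInfm : ∀ m v, Submonoid (Fin lstar → Mm m v))
variable (splitm : ∀ m v, isBad v → Submonoid (Fin lstar → Mm m v))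
variable (splitm_le : ∀ m v (h : isBad v), splitm m v h ≤ gaum m v)
/- the Kummer isomorphisms of labeled data ([IUTchII] Cor. 4.6 (iii)) and the induced identifications of fields -/
variable (κ : ∀ m v, Mm m v ≃* M v) (e : ∀ m v, Km m v ≃ₐ[ℚ_[p]] K v)

/-- The packet transport at `m` carries `Ψ_{𝓕_LGP}(^{n,m}𝓗𝓣)_{v,j}` — gen 4's `LGPMonoidSignature.ofGaussian` at the index-`m`
Frobenius-like data — ONTO `Ψ_LGP(^{n,∘}𝓗𝓣)_{v,j}` — `ofGaussian` at the coric data — as soon as the Kummer isomorphism of labeled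
data carries the Gaussian monoid at `m` onto the coric one ([IUTchII] Cor. 4.6 (iii)/(iv) compatibility).
[cite: Mochizuki2012, Prop. 3.5 (i) p.104] [claim: Mochizuki2012, status: disputed] -/
theorem ofGaussian_Ψ_map_congr (m : ℤ) (hcompat : ∀ v x, e m v (ιm m v x) = ι v (κ m v x))
    (hgau : ∀ v, (gaum m v).map (piIso (Fin lstar) (κ m v)).toMonoidHom = gau v) (v : Vfib) (j : Fin lstar) :
    ((LGPMonoidSignature.ofGaussian p (Km m) (Lgm m) isBad (Mm m) Γ (ιm m) (gaum m) (gauInfm m)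
        (splitm m) (splitm_le m)).Ψ v j).map (lgpPacketCongr p K (Km m) (e m) v j).toMulEquiv =
      (LGPMonoidSignature.ofGaussian p K Lg isBad M Γ ι gau gauInf split split_le).Ψ v j := by
  change (lgpComponent p (Km m) (Mm m) (ιm m) v (gaum m v) j).map _ = lgpComponent p K M ι v (gau v) j
  rw [map_lgpComponent_congr p K (Km m) M ι (Mm m) (ιm m) (κ m) (e m) hcompat, hgau]

/-- The same for the `∞`-versions `∞Ψ_{𝓕_LGP}(^{n,m}𝓗𝓣)_{v,j} ↦ ∞Ψ_LGP(^{n,∘}𝓗𝓣)_{v,j}`. [cite: Mochizuki2012, Prop. 3.5 (i) p.104]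
[claim: Mochizuki2012, status: disputed] -/
theorem ofGaussian_ΨInf_map_congr (m : ℤ) (hcompat : ∀ v x, e m v (ιm m v x) = ι v (κ m v x))
    (hgauInf : ∀ v, (gauInfm m v).map (piIso (Fin lstar) (κ m v)).toMonoidHom = gauInf v)
    (v : Vfib) (j : Fin lstar) :
    ((LGPMonoidSignature.ofGaussian p (Km m) (Lgm m) isBad (Mm m) Γ (ιm m) (gaum m) (gauInfm m)
        (splitm m) (splitm_le m)).ΨInf v j).map (lgpPacketCongr p K (Km m) (e m) v j).toMulEquiv =
      (LGPMonoidSignature.ofGaussian p K Lg isBad M Γ ι gau gauInf split split_le).ΨInf v j := by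
  change (lgpComponent p (Km m) (Mm m) (ιm m) v (gauInfm m v) j).map _ = lgpComponent p K M ι v (gauInf v) j
  rw [map_lgpComponent_congr p K (Km m) M ι (Mm m) (ιm m) (κ m) (e m) hcompat, hgauInf]

/-- "splittings [up to torsion, when `v ∈ 𝕍^bad`]" (p. 104 l. 5–6, l. 27–28): at a bad `v` the packet transport carries the
splitting monoid `Ψ^⊥_{𝓕_LGP}(^{n,m})_{v,j}` onto the coric one whenever `κ` does so on the labeled data.
[cite: Mochizuki2012, Prop. 3.5 (i) p.104] [claim: Mochizuki2012, status: disputed] -/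
theorem ofGaussian_ΨSplit_map_congr (m : ℤ) (hcompat : ∀ v x, e m v (ιm m v x) = ι v (κ m v x))
    {v : Vfib} (h : isBad v) (hsplit : (splitm m v h).map (piIso (Fin lstar) (κ m v)).toMonoidHom = split v h)
    (j : Fin lstar) :
    ((LGPMonoidSignature.ofGaussian p (Km m) (Lgm m) isBad (Mm m) Γ (ιm m) (gaum m) (gauInfm m)
        (splitm m) (splitm_le m)).ΨSplit v h j).map (lgpPacketCongr p K (Km m) (e m) v j).toMulEquiv =
      (LGPMonoidSignature.ofGaussian p K Lg isBad M Γ ι gau gauInf split split_le).ΨSplit v h j := by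
  change (lgpComponent p (Km m) (Mm m) (ιm m) v (splitm m v h) j).map _ = lgpComponent p K M ι v (split v h) j
  rw [map_lgpComponent_congr p K (Km m) M ι (Mm m) (ιm m) (κ m) (e m) hcompat, hsplit]

/-- **[IUTchIII] Proposition 3.5 (i) CONSTRUCTED — `VerticallyCoricLGPData.ofKummer`, the inhabitant of abc-iut-L6-t4's output
signature `VerticallyCoricLGPData` over the genuine packets of one nonarchimedean fibre.** `Ψ_LGP(^{n,∘}𝓗𝓣)_v` / `∞Ψ_LGP` :=
Prop. 3.4 (ii) (gen 4's `LGPMonoidSignature.ofGaussian`) "appl[ied] … to the 𝓕-prime-strips `𝔉(^{n,∘}𝔇_≻)_t` and the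
various full log-links" (p. 103 l. 40–44) — the coric data `K, M, ι, gau, gauInf, split`; `Ψ_{𝓕_LGP}(^{n,m}𝓗𝓣)_v` / `∞Ψ_{𝓕_LGP}`
:= Prop. 3.4 (ii) "where we take '†' to be '`n,m`' and '‡' to be '`n,m−1`'" (p. 104 l. 8–9) — the index-`m` data; the
**Kummer isomorphisms** `Ψ_{𝓕_LGP}(^{n,m}𝓗𝓣)_v ⥲ Ψ_LGP(^{n,∘}𝓗𝓣)_v`, `∞Ψ_{𝓕_LGP}(…)_v ⥲ ∞Ψ_LGP(…)_v` (p. 104 l. 19–26) := the packet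
transport `lgpPacketCongr (e m)` induced by "the Kummer isomorphisms of labeled data … of [IUTchII], Corollary 4.6, (iii),
and the evident identification … of `^{n,m'}𝔉_t`" RESTRICTED to the monoids (`ofGaussian_Ψ_map_congr`); the coric splitting
`Ψ^⊥_LGP(^{n,∘})_v ⊆ Ψ_LGP(^{n,∘})_v` at bad `v`. Hypotheses = the compatibilities the text calls "evident": compatible members
of the log-links (`hcompat`) and `κ(Ψ_{𝓕gau}(^{n,m})) = Ψ_gau(^{n,∘})` (`hgau`, `hgauInf`) — all discharged in the companion file
`VerticallyCoricLGPKummerTransport.lean` (`ofKummerTransport'`). "Vertically coric": `Ψcoric` has no `m`-argument. [cite: Mochizuki2012, Prop. 3.5 (i) p.103]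
[claim: Mochizuki2012, status: disputed] -/
def VerticallyCoricLGPData.ofKummer (hcompat : ∀ m v x, e m v (ιm m v x) = ι v (κ m v x))
    (hgau : ∀ m v, (gaum m v).map (piIso (Fin lstar) (κ m v)).toMonoidHom = gau v)
    (hgauInf : ∀ m v, (gauInfm m v).map (piIso (Fin lstar) (κ m v)).toMonoidHom = gauInf v) :
    VerticallyCoricLGPData lstar Vfib isBad (fun v j => LGPPacket p K v j) (fun m v j => LGPPacket p (Km m) v j) where
  Ψcoric v j := (LGPMonoidSignature.ofGaussian p K Lg isBad M Γ ι gau gauInf split split_le).Ψ v j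
  ΨcoricInf v j := (LGPMonoidSignature.ofGaussian p K Lg isBad M Γ ι gau gauInf split split_le).ΨInf v j
  ΨF m v j := (LGPMonoidSignature.ofGaussian p (Km m) (Lgm m) isBad (Mm m) Γ (ιm m) (gaum m) (gauInfm m)
    (splitm m) (splitm_le m)).Ψ v j
  ΨFInf m v j := (LGPMonoidSignature.ofGaussian p (Km m) (Lgm m) isBad (Mm m) Γ (ιm m) (gaum m) (gauInfm m)
    (splitm m) (splitm_le m)).ΨInf v j
  kummer m v j :=
    ((lgpPacketCongr p K (Km m) (e m) v j).toMulEquiv.submonoidMap _).trans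
      (MulEquiv.submonoidCongr
        (ofGaussian_Ψ_map_congr p K Lg Km Lgm isBad M Γ ι gau gauInf split split_le Mm ιm gaum gauInfm splitm
          splitm_le κ e m (hcompat m) (hgau m) v j))
  kummerInf m v j :=
    ((lgpPacketCongr p K (Km m) (e m) v j).toMulEquiv.submonoidMap _).trans
      (MulEquiv.submonoidCongr
        (ofGaussian_ΨInf_map_congr p K Lg Km Lgm isBad M Γ ι gau gauInf split split_le Mm ιm gaum gauInfm
          splitm splitm_le κ e m (hcompat m) (hgauInf m) v j))
  ΨcoricSplit v h j := (LGPMonoidSignature.ofGaussian p K Lg isBad M Γ ι gau gauInf split split_le).ΨSplit v h j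
  coricSplit_le v h j := (LGPMonoidSignature.ofGaussian p K Lg isBad M Γ ι gau gauInf split split_le).split_le v h j

variable (hcompat : ∀ m v x, e m v (ιm m v x) = ι v (κ m v x))
    (hgau : ∀ m v, (gaum m v).map (piIso (Fin lstar) (κ m v)).toMonoidHom = gau v)
    (hgauInf : ∀ m v, (gauInfm m v).map (piIso (Fin lstar) (κ m v)).toMonoidHom = gauInf v)

/-- **The Kummer isomorphism IS the packet transport** induced by the Kummer isomorphism of labeled data / the identification
of 𝓕-prime-strips, restricted to the monoids (p. 104 l. 9–19 "relative to the Kummer isomorphisms of labeled data … and the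
evident identification"). `rfl`. [cite: Mochizuki2012, Prop. 3.5 (i) p.104] [claim: Mochizuki2012, status: disputed] -/
theorem VerticallyCoricLGPData.ofKummer_kummer_coe (m : ℤ) (v : Vfib) (j : Fin lstar)
    (x : (VerticallyCoricLGPData.ofKummer p K Lg Km Lgm isBad M Γ ι gau gauInf split split_le Mm ιm gaum gauInfm
      splitm splitm_le κ e hcompat hgau hgauInf).ΨF m v j) :
    ((VerticallyCoricLGPData.ofKummer p K Lg Km Lgm isBad M Γ ι gau gauInf split split_le Mm ιm gaum gauInfm
        splitm splitm_le κ e hcompat hgau hgauInf).kummer m v j x : LGPPacket p K v j) =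
      lgpPacketCongr p K (Km m) (e m) v j (x : LGPPacket p (Km m) v j) := rfl

/-- … and its inverse is the inverse transport. `rfl`. [cite: Mochizuki2012, Prop. 3.5 (i) p.104] [claim: Mochizuki2012, status: disputed] -/
theorem VerticallyCoricLGPData.ofKummer_kummer_symm_coe (m : ℤ) (v : Vfib) (j : Fin lstar)
    (y : (VerticallyCoricLGPData.ofKummer p K Lg Km Lgm isBad M Γ ι gau gauInf split split_le Mm ιm gaum gauInfm
      splitm splitm_le κ e hcompat hgau hgauInf).Ψcoric v j) :
    (((VerticallyCoricLGPData.ofKummer p K Lg Km Lgm isBad M Γ ι gau gauInf split split_le Mm ιm gaum gauInfm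
        splitm splitm_le κ e hcompat hgau hgauInf).kummer m v j).symm y : LGPPacket p (Km m) v j) =
      (lgpPacketCongr p K (Km m) (e m) v j).symm (y : LGPPacket p K v j) := rfl

/-- **"vertically coric"** (p. 104 l. 6–7): the étale-like output `Ψ_LGP(^{n,∘}𝓗𝓣)_{v,j}` is, BY TYPE, independent of the
vertical coordinate `m`; it IS the Prop. 3.4 (ii) construction applied to the coric data ("by applying these constructions to
the 𝓕-prime-strips `𝔉(^{n,∘}𝔇_≻)_t`", p. 103 l. 41–42). `rfl`. [cite: Mochizuki2012, Prop. 3.5 (i) p.104]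
[claim: Mochizuki2012, status: disputed] -/
theorem VerticallyCoricLGPData.ofKummer_Ψcoric (v : Vfib) (j : Fin lstar) :
    (VerticallyCoricLGPData.ofKummer p K Lg Km Lgm isBad M Γ ι gau gauInf split split_le Mm ιm gaum gauInfm
        splitm splitm_le κ e hcompat hgau hgauInf).Ψcoric v j =
      (LGPMonoidSignature.ofGaussian p K Lg isBad M Γ ι gau gauInf split split_le).Ψ v j := rfl

/-- **"compatible … with the functorial algorithm of Proposition 3.4, (ii) — i.e., where we take '†' to be '`n,m`'"** (p. 104
l. 7–9): the Frobenius-like monoid at `m` IS gen 4's `LGPMonoidSignature.ofGaussian` at the index-`m` data. `rfl`.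
[cite: Mochizuki2012, Prop. 3.5 (i) p.104] [claim: Mochizuki2012, status: disputed] -/
theorem VerticallyCoricLGPData.ofKummer_ΨF (m : ℤ) (v : Vfib) (j : Fin lstar) :
    (VerticallyCoricLGPData.ofKummer p K Lg Km Lgm isBad M Γ ι gau gauInf split split_le Mm ιm gaum gauInfm
        splitm splitm_le κ e hcompat hgau hgauInf).ΨF m v j =
      (LGPMonoidSignature.ofGaussian p (Km m) (Lgm m) isBad (Mm m) Γ (ιm m) (gaum m) (gauInfm m)
        (splitm m) (splitm_le m)).Ψ v j := rfl

/-- Two vertical indices `m, m'` of the column: the composite `Ψ_{𝓕_LGP}(^{n,m})_{v,j} ⥲ Ψ_LGP(^{n,∘})_{v,j} ⥲ Ψ_{𝓕_LGP}(^{n,m'})_{v,j}`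
of the Kummer isomorphisms is the transport along `e_{m'}⁻¹ ∘ e_m` — the shape of the "log-Kummer correspondence" of (ii)
(p. 106), recorded at the level of (i). `rfl`. [cite: Mochizuki2012, Prop. 3.5 (i) p.104] [claim: Mochizuki2012, status: disputed] -/
theorem VerticallyCoricLGPData.ofKummer_kummer_trans_coe (m m' : ℤ) (v : Vfib) (j : Fin lstar)
    (x : (VerticallyCoricLGPData.ofKummer p K Lg Km Lgm isBad M Γ ι gau gauInf split split_le Mm ιm gaum gauInfm
      splitm splitm_le κ e hcompat hgau hgauInf).ΨF m v j) :
    let D := VerticallyCoricLGPData.ofKummer p K Lg Km Lgm isBad M Γ ι gau gauInf split split_le Mm ιm gaum gauInfm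
      splitm splitm_le κ e hcompat hgau hgauInf
    (((D.kummer m v j).trans (D.kummer m' v j).symm x : D.ΨF m' v j) : LGPPacket p (Km m') v j) =
      (lgpPacketCongr p K (Km m') (e m') v j).symm (lgpPacketCongr p K (Km m) (e m) v j (x : LGPPacket p (Km m) v j)) :=
  rfl

end Construction

end Literature.IUT.LogThetaLattice

end
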